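import Mathlib.Topology.ContinuousMap.Basic
import Mathlib.Topology.CompactOpen
import Mathlib.MeasureTheory.Constructions.BorelSpace.ContinuousLinearMap
import Mathlib.MeasureTheory.Measure.Prod
import Mathlib.MeasureTheory.Measure.MutuallySingular
import Mathlib.Order.LiminfLimsup
import Literature.Analysis.FluidPDE.PassiveScalar
import Literature.Analysis.FluidPDE.PlanarEigenmodeFlows
import Literature.Analysis.FunctionSpaces.TorusTestFunction
import HarnessLib

/-!
# The DiPerna–Lions renormalization property excludes dissipation anomalies of passive scalars;
  random continuous autonomous planar fields have it (Bagnara–Boutros–De Lellis–Mayboroda 2026,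
  Def. 1.1, Thm. 1.2, Def. 2.1–2.2, §2.2, Thm. 3.1 — faithful statements)

Topic `Analysis/FluidPDE`; the RIGID-side companion of `ObukhovCorrsinAnomalousDissipation.lean`
(Colombo–Crippa–Sorella 2023), `AnomalousDissipationOnsagerCritical.lean` (BCCDS 2024),
`AnomalousDissipationTwoHalfD.lean` (Bruè–De Lellis 2023, §3) and `JohanssonSorellaAutonomousForce.lean`
(autonomous planar fields WITH a dissipation anomaly); vocabulary `Torus.IsWeakScalarTransportOn`,
`Torus.eScalarDissipation` (`PassiveScalar.lean`), `FunctionSpaces.Torus.IsWeaklyDivFree`, `stLift`,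
`IsContDiff`, `Torus.fderiv`, `Torus.gradient` (`TorusCalculus.lean`, `TorusTestFunction.lean`) and the planar
rotation `PlanarEigenmode.perp` (`PlanarEigenmodeFlows.lean`) reused, never redeclared.

M. Bagnara, D. W. Boutros, C. De Lellis, S. Mayboroda, *Regularity thresholds for anomalous dissipation
and related phenomena in passive scalars*, arXiv:2603.11466 (**v3**, 16 Jul 2026; unrefereed preprint —
the theorems below carry `claim … under-review` tags, D-0012). Held as `paper:arxiv-2603.11466` (PDF
page render); all locators are arXiv-v3 PDF pages, page-confirmed 2026-08-27: **Definition 1.1**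
(allows a dissipation anomaly) p. 2; **Theorem 1.2** (two-dimensional case) pp. 2–3; Conjecture 1.3
p. 3; Theorem 1.4 (three-dimensional Clebsch case) p. 3; Theorem 1.5 pp. 3–4; **Definition 2.1**
(bounded weak solutions (2.1)–(2.2), DiPerna–Lions renormalization property) p. 5; **§2.2** (proof of
the renormalization part of Thm. 1.2: Fubini + Alberti–Bianchini–Crippa) pp. 5–6; **Definition 2.2**
(weak Sard property) and Proposition 2.3 p. 6; Theorem 2.4 p. 6; **Theorem 3.1** p. 11 with proof
pp. 11–12 ((3.1)–(3.3)); Proposition 3.2 p. 12, Remark 3.3 p. 13; Definition 3.4 / Proposition 3.5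
(weak Richardson dispersion) p. 13; Theorem 3.7 (Yaglom's law, spherical averages (3.10)) p. 16.

The tree cites this source in prose in `Summits/…/Theses/TwoAndHalfD.lean` ("autonomous weak-Sard
planar fields carry no dissipation anomaly, arXiv:2603.11466 Thm 1.2"), `…/SawtoothPulseCascade.lean`
and the barrier files `GravestModeLaminarAttractor` (Thm. 3.1), `ShearFlowViscositySelection`,
`ObukhovCorrsinThreshold`, `ConvexIntegrationNonLeray`; no typed statement existed before this file.

## Contents

* `Torus.IsBoundedOnSlab T θ` — plumbing: `θ ∈ L^∞((0,T) × T^d)` through the space–time lift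
  (the form in which `PassiveScalar.lean` phrases bounded drifts).
* `Torus.HasRenormalizationPropertyOn T v` — **Definition 2.1** on the horizon `[0,T)`.
* `Torus.AllowsDissipationAnomalyOn T v` — **Definition 1.1** on the horizon `T`.
* `Torus.perpGradient`, `Torus.HasWeakSardProperty` — the planar stream-function relation
  `v = ∇^⊥ψ` and **Definition 2.2** (weak Sard property of a `C¹` map, critical set = points where
  the differential is not onto).
* `BagnaraEtAl2026_thm31` — **Theorem 3.1** (named fact): renormalization ⇒ no dissipation anomaly,
  `ε ∫₀ᵀ‖∇θ_ε‖² → 0` and `θ_ε → θ₀` in `L^∞(0,T;L²)`, `θ₀` the unique bounded weak transport solution.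
  **ERRATUM 2026-08-29 (finding L30-1): FALSE AS TYPED** — the hypothesis is renormalization on the
  HALF-OPEN window `[0,T)` (the tree's weak class), the conclusion is on the full window; counterexample
  Drivas–Elgindi–Iyer–Jeong 2022 (tree theorem `deij_anomalous_dissipation_eventually_holds`); see the
  docstring of the def.  Corrected statements, proved: `Barriers/AnomalousDissipation/RenormalisationNoAnomaly`
  (`BagnaraBoutrosDeLellisMayboroda2026_thm31{,_strong}`) and `…/RenormalisationNoAnomalyFullWindow`
  (`…_thm31_fullWindow`, renormalization on a longer horizon `T' > T` ⇒ the full-window conclusion).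
* `BagnaraEtAl2026_thm12_core` — the deterministic statement established in **§2.2** (named fact):
  a continuous autonomous divergence-free field on `T²` whose zero set is Lebesgue-null has the
  renormalization property (Alberti–Bianchini–Crippa's theorem transplanted to `T²`).
* `BagnaraEtAl2026_weakSard` — the implication used on pp. 5–6 from [3] (named fact): for a
  continuous mean-zero divergence-free `v = ∇^⊥ψ` on `T²`, `ψ ∈ C¹`, weak Sard (Def. 2.2) ⇒
  renormalization (the printed "equivalent" concerns the `E*`-restricted notion of [3]; see the
  docstring's fidelity note).
* `BagnaraEtAl2026_thm12` — **Theorem 1.2** (statement, the renormalization and no-anomaly clauses)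
  and the PROVED reduction `BagnaraEtAl2026_thm12_of` : `thm12_core → thm31 → thm12` (the source's
  "two lines proof": Fubini on `P ⊗ L²` and Theorem 3.1), plus the proved corollary shape
  `Torus.not_allowsDissipationAnomalyOn_of_tendsto` (Thm. 3.1's conclusion ⇒ ¬ Def. 1.1).  Since `thm31`
  is false as typed (ERRATUM above), the reduction of record is
  `Literature.Barriers.AnomalousDissipation.BagnaraEtAl2026_thm12_of_core : thm12_core → thm12`
  (`Barriers/AnomalousDissipation/RenormalisationNoAnomalyFullWindow`; autonomous fields renormalize on
  every horizon, so the full-window theorem applies with `T' = T + 1`).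

## Rendering and faithfulness notes

* Weak solutions. The source's bounded weak solutions ((2.2) p. 5: bounded `θ`, tests
  `φ ∈ C¹_c(T^d × ℝ)`, datum encoded by `∫ θ_in φ(·,0)`) are rendered by the tree's DiPerna–Lions class
  `Torus.IsWeakScalarTransportOn T κ v θ_in θ` (`θ ∈ L^∞_t L²_x`, smooth space–time tests vanishing
  near `t = T`, possibly nonzero at `t = 0`; `κ = 0` allowed) PLUS boundedness `IsBoundedOnSlab T θ`;
  for bounded `θ`, `v` on a finite slab the integrability clauses of the class are automatic and smooth
  tests are equivalent to `C¹_c` tests by density. The horizon: Def. 1.1 takes `v` on `T^d × [0,1]`,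
  Thm. 3.1 on `T^d × [0,T]`; every notion here carries the horizon `T` explicitly.
* "The unique bounded solution `θ_ε`" (Def. 1.1, Thm. 3.1): for `ε > 0` and bounded divergence-free
  `v` bounded weak solutions exist and are unique (maximum principle; Le Bris–Lions 2008 / Figalli 2008,
  cf. the docstring of `Torus.IsWeakScalarTransportOn.unique_of_lipschitz`); the statements below
  quantify over ALL families `(θ_ε)_{ε>0}` of bounded weak solutions, which under existence and
  uniqueness is literally the printed statement and involves no choice.
* `C([0,T];L²)` convergence in Thm. 3.1 holds for the time-continuous representatives ("up to a
  suitable choice of representative", p. 11); for the a.e.-defined slices of the weak class it is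
  rendered as `ess sup_{t∈(0,T)} ‖θ_ε(t) - θ₀(t)‖_{L²} → 0`, which is what it says about any
  representatives.
* Theorem 1.2 is typed with its first two conclusions (renormalization property; no dissipation
  anomaly). The remaining three (no weak Richardson dispersion, Prop. 3.5 — stochastic flows (3.5); no
  anomalous regularization, Prop. 3.2; failure of Yaglom's law, Thm. 3.7 — spherical averages (3.10))
  need a stochastic-Lagrangian / structure-function vocabulary the tree does not have on `T^d` and are
  NOT part of the typed statement (a weakening by omission, recorded here; nothing is strengthened).
  "A probability measure on the space of continuous divergence-free autonomous vector fields" is a Borel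
  probability measure on `C(T², ℝ²)` (compact-open = uniform topology) giving full measure to weakly
  divergence-free fields.
* Conjecture 1.3 (weak Sard ⟺ anomaly for autonomous planar fields) is an open problem, not
  Literature (its "if" direction is reported refuted by Pappalettera, arXiv:2607.27044); Theorems 1.4,
  1.5, 2.4 (random Clebsch fields / random Morse–Sard in `d ≥ 3`) are not typed here.

## References

* M. Bagnara, D. W. Boutros, C. De Lellis, S. Mayboroda, arXiv:2603.11466v3 (2026). [`BagnaraEtAl2026`]
* G. Alberti, S. Bianchini, G. Crippa, *A uniqueness result for the continuity equation in two
  dimensions*, J. Eur. Math. Soc. 16 (2014) 201–234 (the input [3] of §2.2). [`AlbertiBianchiniCrippa2014`]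
* R. J. DiPerna, P.-L. Lions, Invent. Math. 98 (1989) (renormalized solutions). [`DiPernaLions1989`]
-/

open MeasureTheory Set Filter Function
open scoped ENNReal NNReal Topology ContDiff

noncomputable section

namespace Literature.Analysis.FluidPDE

open Literature.Analysis.FunctionSpaces

namespace Torus

variable {d : Type*} [Fintype d]

/-! ## Plumbing and Definitions 1.1, 2.1, 2.2 -/

/-- `θ ∈ L^∞((0,T) × T^d)`: the space–time lift `stLift θ : ℝ × ℝ^d → ℝ` is essentially bounded (and
a.e. strongly measurable) for Lebesgue measure restricted to `(0,T) × ℝ^d` — the form in which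
`PassiveScalar.lean` phrases "bounded drift" (`MemLp (stLift u) ∞ (volume.restrict (Ioo 0 T ×ˢ univ))`).
Used for the source's "bounded weak solution" / "bounded vector field" (Def. 2.1 p. 5, Thm. 3.1 p. 11).
[cite: BagnaraEtAl2026, Def. 2.1 p. 5] -/
def IsBoundedOnSlab {F : Type*} [NormedAddCommGroup F] (T : ℝ) (θ : ℝ → UnitAddTorus d → F) : Prop :=
  MemLp (FunctionSpaces.Torus.stLift θ) ∞ (volume.restrict (Ioo 0 T ×ˢ univ))

/-- **The DiPerna–Lions renormalization property** (Bagnara–Boutros–De Lellis–Mayboroda 2026,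
Definition 2.1 p. 5, after DiPerna–Lions 1989), on the horizon `[0,T)`: for every bounded initial datum
`θ_in`, every BOUNDED weak solution `θ` of the transport equation `∂ₜθ + (v·∇)θ = 0`, `θ(·,0) = θ_in`
(2.1)–(2.2) — the tree's weak class `Torus.IsWeakScalarTransportOn T 0 v θ_in θ` with `κ = 0` — and every
`β ∈ C¹(ℝ)`, the scalar `β(θ)` is a weak solution of (2.1) with initial datum `β(θ_in)`. The source
states it for "a bounded divergence-free vector field on `T^d` (not necessarily autonomous)"; weak
divergence-freeness of `v` at a.e. time is part of the tree's weak class.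
[cite: BagnaraEtAl2026, Def. 2.1 p. 5] -/
def HasRenormalizationPropertyOn (T : ℝ) (v : ℝ → UnitAddTorus d → EuclideanSpace ℝ d) : Prop :=
  ∀ ⦃θin : UnitAddTorus d → ℝ⦄ ⦃θ : ℝ → UnitAddTorus d → ℝ⦄,
    MemLp θin ∞ volume → IsBoundedOnSlab T θ → IsWeakScalarTransportOn T 0 v θin θ →
    ∀ β : ℝ → ℝ, ContDiff ℝ 1 β →
      IsWeakScalarTransportOn T 0 v (fun x => β (θin x)) (fun t x => β (θ t x))

/-- **`v` allows a dissipation anomaly** on the horizon `T` (Bagnara–Boutros–De Lellis–Mayboroda 2026,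
Definition 1.1 p. 2): there is a bounded initial datum `θ_in ∈ L^∞(T^d)` such that the bounded solutions
`θ_ε` (`ε > 0`) of the advection–diffusion equations `∂ₜθ_ε + (v·∇)θ_ε = εΔθ_ε`, `θ_ε(·,0) = θ_in` (1.2)
satisfy `limsup_{ε↓0} ε ∫₀ᵀ ∫_{T^d} |∇θ_ε|² dx dt > 0`. Rendering: "`θ_ε` denotes the unique bounded
solution" becomes a family `(θ_ε)_{ε>0}` of bounded weak solutions (`IsWeakScalarTransportOn T ε v θ_in (θ ε)`
and `IsBoundedOnSlab T (θ ε)`) whose spectral dissipation `Torus.eScalarDissipation ε (θ ε) 0 T` has positive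
`limsup` along `ε → 0⁺` (`𝓝[>] 0`, values in `[0,∞]`); for bounded divergence-free `v` the bounded weak
solution exists and is unique for each `ε > 0`, so this is the printed notion. Negated twin over all weak
solutions from one datum: `Torus.HasAnomalousScalarDissipation` (`ObukhovCorrsinAnomalousDissipation.lean`).
[cite: BagnaraEtAl2026, Def. 1.1 p. 2] -/
def AllowsDissipationAnomalyOn (T : ℝ) (v : ℝ → UnitAddTorus d → EuclideanSpace ℝ d) : Prop :=
  ∃ (θin : UnitAddTorus d → ℝ) (θ : ℝ → ℝ → UnitAddTorus d → ℝ),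
    MemLp θin ∞ volume ∧
    (∀ ε, 0 < ε → IsBoundedOnSlab T (θ ε) ∧ IsWeakScalarTransportOn T ε v θin (θ ε)) ∧
    0 < limsup (fun ε => eScalarDissipation ε (θ ε) 0 T) (𝓝[>] (0 : ℝ))

/-- The perpendicular gradient `∇^⊥ψ = (-∂₂ψ, ∂₁ψ)` of a planar scalar `ψ : T² → ℝ` — the
divergence-free field with STREAM FUNCTION `ψ` (Bagnara–Boutros–De Lellis–Mayboroda 2026, §2.2 p. 5:
"we can introduce the stream function `φ` of `v`"; sign convention immaterial for the critical set
`{∇ψ = 0} = {∇^⊥ψ = 0}`): the torus twin of the planar `Literature.Analysis.FluidPDE.PlanarEigenmode.perpGrad`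
(`PlanarEigenmodeFlows.lean`, stream functions on `ℝ²`), built with the same rotation
`Literature.Analysis.FluidPDE.PlanarEigenmode.perp k = (-k₂, k₁)` applied to the tree's `Torus.gradient`.
[cite: BagnaraEtAl2026, §2.2 p. 5] -/
def perpGradient (ψ : UnitAddTorus (Fin 2) → ℝ) (x : UnitAddTorus (Fin 2)) : EuclideanSpace ℝ (Fin 2) :=
  PlanarEigenmode.perp (FunctionSpaces.Torus.gradient ψ x)

/-- **Weak Sard property** of a `C¹` map `φ : T^d → F` into a finite-dimensional space
(Bagnara–Boutros–De Lellis–Mayboroda 2026, Definition 2.2 p. 6, after Alberti–Bianchini–Crippa 2014):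
with the critical set `Z = {x : rank Dφ(x) ≤ dim F - 1} = {x : Dφ(x) is not onto}` (for `F = ℝ^{d-1}`:
`rank ≤ d - 2`; for a planar stream function, `F = ℝ`: `Z = {∇φ = 0}`), the push-forward `φ_♯(1_Z L^d)` is
singular with respect to Lebesgue measure on `F`. `Dφ(x)` is the tree's `Torus.fderiv φ x` (junk `0`, hence
"critical", where `φ` is not differentiable — immaterial for `C¹` maps); `Measure.map` of a non-measurable
`φ` is `0` (junk: the property then holds) — immaterial for continuous `φ`.
[cite: BagnaraEtAl2026, Def. 2.2 p. 6] -/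
def HasWeakSardProperty {F : Type*} [NormedAddCommGroup F] [NormedSpace ℝ F] [MeasureSpace F]
    (φ : UnitAddTorus d → F) : Prop :=
  (Measure.map φ ((volume : Measure (UnitAddTorus d)).restrict
      {x | ¬ Function.Surjective (FunctionSpaces.Torus.fderiv φ x)})) ⟂ₘ (volume : Measure F)

end Torus

/-! ## Theorem 3.1 — renormalization excludes dissipation anomalies (named fact) -/

/-- **Bagnara–Boutros–De Lellis–Mayboroda 2026, Theorem 3.1** (p. 11, proof pp. 11–12; presented by the
source as a folklore consequence of the DiPerna–Lions theory, "without claiming any originality", §1 p. 2).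
«Consider a bounded divergence-free vector field `v : T^d × [0,T] → ℝ^d` which satisfies the
renormalization property. Let `θ_in` be a bounded initial datum and for any `ε > 0` we denote by `θ_ε` the
unique bounded solution of equation (1.2). Then we have `lim_{ε↓0} ε ∫₀ᵀ ∫_{T^d} |∇θ_ε|²(x,t) dx dt = 0`
(3.1) and `θ_ε` converges strongly in `C([0,T], L²(T^d))` to the unique bounded weak solution of (2.1).»
Typed: for `T > 0`, a space–time measurable, bounded (`IsBoundedOnSlab`), a.e.-in-time weakly
divergence-free drift `v` with `HasRenormalizationPropertyOn T v`, and a bounded datum: (i) every family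
`(θ_ε)_{ε>0}` of bounded weak solutions has `ε ∫₀ᵀ ‖∇θ_ε‖² → 0` as `ε → 0⁺` (`Torus.eScalarDissipation`,
spectral, `[0,∞]`-valued); (ii) there is a bounded weak solution `θ₀` of the transport problem (`κ = 0`),
unique up to a.e. equality on `(0,T) × T^d` among bounded weak solutions, with
`ess sup_{t∈(0,T)} ‖θ_ε(t) - θ₀(t)‖_{L²} → 0` (see the module docstring for the `C([0,T];L²)` rendering).
Proof in the source: weak-* compactness and the maximum principle, uniqueness of bounded weak transport
solutions under renormalization ([24, Thm 3.3 & Prop 3.6]), equi-Lipschitz `t ↦ ∫θ_εφ`, the energy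
identity (3.2), lower semicontinuity (3.3) and conservation of `‖θ₀(t)‖_{L²}` from the renormalization
with `β(s) = s²`.

**ERRATUM (finding L30-1, ad-ideate literature seat, 2026-08-29): THIS PROP IS FALSE AS TYPED — do not take
`(h : BagnaraEtAl2026_thm31)` as a hypothesis.**  The tree's weak class `Torus.IsWeakScalarTransportOn T …`
is posed on the HALF-OPEN window `[0,T)` (its tests vanish for `t ≥ T'`, some `T' < T`,
`FunctionSpaces.Torus.IsSpaceTimeTest`), so `Torus.HasRenormalizationPropertyOn T v` constrains the
dynamics only strictly before `T`, whereas conjunct (i) concludes on the FULL window `(0,T)` (and (ii) asks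
ess-sup-in-time convergence up to `T`).  Counterexample: the field of Drivas–Elgindi–Iyer–Jeong, Arch.
Ration. Mech. Anal. 243 (2022), Thms. 1–2 (arXiv:1911.03271 p. 3) — `u ∈ C^∞([0,T) × T^d) ∩ L^∞([0,T] × T^d)`,
divergence free, with `κ ∫₀ᵀ ‖∇θ^κ‖² ≥ χ ‖θ₀‖²_{L²} > 0` for a bounded mean-zero datum; a THEOREM of the
tree (`Literature.Analysis.FluidPDE.deij_anomalous_dissipation_eventually_holds`).  Such a `u` is bounded
(`IsBoundedOnSlab T u`), divergence free, and — being Lipschitz on every `[0,t] × T^d`, `t < T`, where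
bounded weak transport solutions are unique and renormalised [cite: DiPernaLions1989, §II.3 Cor. II.1] —
HAS `HasRenormalizationPropertyOn T u` (every `IsSpaceTimeTest T` test is supported in some `[0,t]`,
`t < T`), yet its dissipation over `(0,T)` does not vanish.  The PRINTED theorem is not affected:
Definition 2.1 (p. 5) poses weak solutions on `T^d × [0,∞)` with tests in `C¹_c(T^d × ℝ)`, a notion that
sees the endpoint `T` (DEIJ's field continued past `T` is not renormalising).  CORRECTED STATEMENTS, all
PROVED: `Literature.Barriers.AnomalousDissipation.BagnaraBoutrosDeLellisMayboroda2026_thm31` (dissipation on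
`[0,t₁]`, every `t₁ < T`), `…_thm31_strong` (`L²((0,T) × T^d)` convergence to the transport solution)
(`Barriers/AnomalousDissipation/RenormalisationNoAnomaly`), and
`…BagnaraBoutrosDeLellisMayboroda2026_thm31_fullWindow{,_nhdsWithin}` /
`…not_allowsDissipationAnomalyOn_of_hasRenormalizationPropertyOn_beyond` (the FULL-window conclusion
(3.1) and `¬ AllowsDissipationAnomalyOn T v` under renormalisation on a LONGER horizon `T' > T`; the two
renormalisation notions of the tree coincide, `…hasRenormalisationProperty_iff_hasRenormalizationPropertyOn`)
(`Barriers/AnomalousDissipation/RenormalisationNoAnomalyFullWindow`).  The in-file reduction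
`BagnaraEtAl2026_thm12_of` below stays a true implication from a false premise; Theorem 1.2 as typed
(`BagnaraEtAl2026_thm12`) is TRUE and follows from `BagnaraEtAl2026_thm12_core` ALONE
(`Literature.Barriers.AnomalousDissipation.BagnaraEtAl2026_thm12_of_core`: an autonomous field renormalises
on every horizon).  The definition below is kept verbatim (D-0014: a vendored def's meaning is never edited
in place; no file imports it). [claim: BagnaraEtAl2026, status: under-review] -/
def BagnaraEtAl2026_thm31 : Prop :=
  ∀ (d : Type) [Fintype d] (T : ℝ), 0 < T →
    ∀ (v : ℝ → UnitAddTorus d → EuclideanSpace ℝ d),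
      Torus.IsBoundedOnSlab T v →
      (∀ᵐ t ∂(volume.restrict (Ioo 0 T)), FunctionSpaces.Torus.IsWeaklyDivFree (v t)) →
      Torus.HasRenormalizationPropertyOn T v →
      ∀ (θin : UnitAddTorus d → ℝ), MemLp θin ∞ volume →
        ∀ (θ : ℝ → ℝ → UnitAddTorus d → ℝ),
          (∀ ε, 0 < ε → Torus.IsBoundedOnSlab T (θ ε) ∧ Torus.IsWeakScalarTransportOn T ε v θin (θ ε)) →
          Tendsto (fun ε => Torus.eScalarDissipation ε (θ ε) 0 T) (𝓝[>] (0 : ℝ)) (𝓝 0) ∧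
          ∃ θ₀ : ℝ → UnitAddTorus d → ℝ,
            Torus.IsBoundedOnSlab T θ₀ ∧ Torus.IsWeakScalarTransportOn T 0 v θin θ₀ ∧
            (∀ θ₀' : ℝ → UnitAddTorus d → ℝ, Torus.IsBoundedOnSlab T θ₀' →
              Torus.IsWeakScalarTransportOn T 0 v θin θ₀' →
              ∀ᵐ t ∂(volume.restrict (Ioo 0 T)), θ₀' t =ᵐ[volume] θ₀ t) ∧
            Tendsto (fun ε => essSup (fun t => eLpNorm (fun x => θ ε t x - θ₀ t x) 2 volume)
              (volume.restrict (Ioo 0 T))) (𝓝[>] (0 : ℝ)) (𝓝 0)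

/-! ## §2.2 and Theorem 1.2 — continuous autonomous planar fields -/

/-- **Bagnara–Boutros–De Lellis–Mayboroda 2026, §2.2 pp. 5–6 — the deterministic statement proved there
(the renormalization part of Theorem 1.2).** «with probability one the zero set of the vector field `v` has
measure zero. Assume now for the moment that the average of `v` is zero, so that we can introduce the
stream function `φ` of `v`. We then conclude that the measure `μ := 1_{∇φ=0} L²` vanishes identically …
and in particular that `φ` satisfies the weak Sard property in [3] … This is then proved in [3] to be
equivalent to the DiPerna–Lions renormalization property.» and (p. 6) «If `v` does not have average `0` …
a stream function exists in every subset `Ω` which is simply connected. The result in [3] can then be used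
… a simple partition of unity allows then to show that `β(θ)` is in fact a distributional solution on the
whole torus.» Typed: a continuous, weakly divergence-free autonomous field `v` on `T²` whose zero set
`{x : v(x) = 0}` is Lebesgue-null has the renormalization property on every horizon `T > 0`
([3] = Alberti–Bianchini–Crippa, JEMS 16 (2014)). [claim: BagnaraEtAl2026, status: under-review] -/
def BagnaraEtAl2026_thm12_core : Prop :=
  ∀ (v : UnitAddTorus (Fin 2) → EuclideanSpace ℝ (Fin 2)), Continuous v → FunctionSpaces.Torus.IsWeaklyDivFree v →
    (volume : Measure (UnitAddTorus (Fin 2))) {x | v x = 0} = 0 →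
    ∀ T : ℝ, 0 < T → Torus.HasRenormalizationPropertyOn T (fun _ => v)

/-- **Bagnara–Boutros–De Lellis–Mayboroda 2026, §2.2 pp. 5–6 (weak Sard ⇒ renormalization on `T²`,
from [3]).** For a continuous, average-free, divergence-free autonomous field on `T²` written through its
stream function, `v = ∇^⊥ψ` with `ψ ∈ C¹(T²)`: «`φ` satisfies the weak Sard property in [3], which is the
condition `φ_♯μ ⊥ L¹` [`μ = 1_{∇φ=0}L²`] (see Definition 2.2). This is then proved in [3] to be equivalent
to the DiPerna–Lions renormalization property.» Typed as the IMPLICATION, on every horizon `T > 0`, from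
`Torus.HasWeakSardProperty ψ` (Def. 2.2 with `F = ℝ`, critical set `Z = {∇ψ = 0}`) to
`Torus.HasRenormalizationPropertyOn T (fun _ => ∇^⊥ψ)` — the direction the source USES in §2.2 (the
notion in which its question 1.3 p. 3 is phrased). FIDELITY NOTE (a weakening, deliberately): the
printed word "equivalent" refers to the weak Sard property of [3] = Alberti–Bianchini–Crippa, JEMS 16
(2014), which restricts the critical set to `Z ∩ E*`, `E*` the union of the level-set components of
positive length; Definition 2.2 (no `E*`) is the stronger "relaxed Sard property", and the two notions
differ for `C^{1,α}` Hamiltonians (Pappalettera, arXiv:2607.27044v2, p. 2, after [DGG26]); since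
`ψ_♯(1_{Z∩E*}L²) ≤ ψ_♯(1_Z L²)`, Def. 2.2 implies the weak Sard property of [3] and hence renormalization,
while the converse for Def. 2.2's notion is not what [3] proves — so only this direction is vendored
([3] is stated for bounded divergence-free autonomous fields on the plane; the torus transplant is the
source's, p. 6). [claim: BagnaraEtAl2026, status: under-review] -/
def BagnaraEtAl2026_weakSard : Prop :=
  ∀ (ψ : UnitAddTorus (Fin 2) → ℝ), FunctionSpaces.Torus.IsContDiff 1 ψ →
    Torus.HasWeakSardProperty ψ →
    ∀ T : ℝ, 0 < T → Torus.HasRenormalizationPropertyOn T (fun _ => Torus.perpGradient ψ)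

/-- **Bagnara–Boutros–De Lellis–Mayboroda 2026, Theorem 1.2 (Two-dimensional case)** (pp. 2–3), the
renormalization and no-dissipation-anomaly clauses. «Consider a probability measure `P` on the space of
continuous divergence-free autonomous vector fields `v` on `T²`. Assume that `P({v : v(x) = 0}) = 0` for
a.e. `x ∈ T²`. Then `P`-almost surely `v` satisfies the DiPerna–Lions renormalization property (cf.
Definition 2.1) and thus does not allow dissipation anomalies (cf. Theorem 3.1), does not support Richardson
dispersion (cf. Proposition 3.5), does not display anomalous regularization (cf. Proposition 3.2), and
violates Yaglom's law (under the interpretation of Theorem 3.7).» Typed: for a Borel probability measure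
`P` on `C(T², ℝ²)` giving full measure to weakly divergence-free fields, with `P {v : v x = 0} = 0` for
a.e. `x`, `P`-a.e. field has, on every horizon `T > 0`, the renormalization property and allows no
dissipation anomaly (Defs. 2.1, 1.1). The Richardson / regularization / Yaglom clauses are NOT typed
(module docstring). Proved below from `BagnaraEtAl2026_thm12_core` and `BagnaraEtAl2026_thm31`
(`BagnaraEtAl2026_thm12_of`), which is the source's proof. [claim: BagnaraEtAl2026, status: under-review] -/
def BagnaraEtAl2026_thm12 : Prop :=
  ∀ [MeasurableSpace C(UnitAddTorus (Fin 2), EuclideanSpace ℝ (Fin 2))]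
    [BorelSpace C(UnitAddTorus (Fin 2), EuclideanSpace ℝ (Fin 2))]
    (P : Measure C(UnitAddTorus (Fin 2), EuclideanSpace ℝ (Fin 2))) [IsProbabilityMeasure P],
    (∀ᵐ (v : C(UnitAddTorus (Fin 2), EuclideanSpace ℝ (Fin 2))) ∂P,
      FunctionSpaces.Torus.IsWeaklyDivFree (fun x => v x)) →
    (∀ᵐ x ∂(volume : Measure (UnitAddTorus (Fin 2))), P {v | v x = 0} = 0) →
    ∀ᵐ (v : C(UnitAddTorus (Fin 2), EuclideanSpace ℝ (Fin 2))) ∂P, ∀ T : ℝ, 0 < T →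
      Torus.HasRenormalizationPropertyOn T (fun _ x => v x) ∧
        ¬ Torus.AllowsDissipationAnomalyOn T (fun _ x => v x)

/-! ## Proved API and the reduction Theorem 1.2 ⇐ (§2.2 + Theorem 3.1) -/

namespace Torus

variable {d : Type*} [Fintype d]

/-- **No dissipation anomaly from Theorem 3.1's conclusion**: if for every bounded datum every family of
bounded weak solutions has dissipation `→ 0`, then `v` does not allow a dissipation anomaly on `[0,T]`
(Def. 1.1). [cite: BagnaraEtAl2026, Thm. 1.2 p. 2 with Thm. 3.1 p. 11] -/
theorem not_allowsDissipationAnomalyOn_of_tendsto {T : ℝ} {v : ℝ → UnitAddTorus d → EuclideanSpace ℝ d}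
    (h : ∀ (θin : UnitAddTorus d → ℝ), MemLp θin ∞ volume →
      ∀ (θ : ℝ → ℝ → UnitAddTorus d → ℝ),
        (∀ ε, 0 < ε → IsBoundedOnSlab T (θ ε) ∧ IsWeakScalarTransportOn T ε v θin (θ ε)) →
        Tendsto (fun ε => eScalarDissipation ε (θ ε) 0 T) (𝓝[>] (0 : ℝ)) (𝓝 0)) :
    ¬ AllowsDissipationAnomalyOn T v := by
  rintro ⟨θin, θ, hθin, hfam, hpos⟩
  have h0 := (h θin hθin θ hfam).limsup_eq
  rw [h0] at hpos
  exact lt_irrefl _ hpos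

end Torus

/-- **Theorem 1.2 from §2.2 and Theorem 3.1** — the source's proof ("it suffices to apply Fubini's theorem
to reduce it to a powerful deterministic result of Alberti, Bianchini, and Crippa", p. 3; §2.2 p. 5:
`∫ L²({v = 0}) dP(v) = ∫_{T²} P({v : v(x) = 0}) dx = 0`): the evaluation `(v, x) ↦ v(x)` is continuous on
`C(T², ℝ²) × T²`, so `{(v,x) : v(x) = 0}` is closed, hence measurable for the product σ-algebra (`T²` is
second countable); Tonelli in both orders gives `L²({v = 0}) = 0` for `P`-a.e. `v`; `BagnaraEtAl2026_thm12_core`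
gives the renormalization property and `BagnaraEtAl2026_thm31`, applied to the bounded autonomous field,
kills every dissipation anomaly (`Torus.not_allowsDissipationAnomalyOn_of_tendsto`).
[cite: BagnaraEtAl2026, Thm. 1.2 pp. 2–3 and §2.2 p. 5 (proof)] -/
theorem BagnaraEtAl2026_thm12_of (hcore : BagnaraEtAl2026_thm12_core) (h31 : BagnaraEtAl2026_thm31) :
    BagnaraEtAl2026_thm12 := by
  intro _ _ P _ hdiv hzero
  -- the zero set `S = {(v, x) : v x = 0}` is closed in `C(T², ℝ²) × T²`
  set S : Set (C(UnitAddTorus (Fin 2), EuclideanSpace ℝ (Fin 2)) × UnitAddTorus (Fin 2)) := {p | p.1 p.2 = 0} with hS_def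
  have hS : IsClosed S := isClosed_eq (continuous_eval) continuous_const
  have hSm : MeasurableSet S := hS.measurableSet
  -- Tonelli: `(P ⊗ vol) S = ∫ P {v | v x = 0} dx = 0`
  have hprod : (P.prod (volume : Measure (UnitAddTorus (Fin 2)))) S = 0 := by
    rw [Measure.prod_apply_symm hSm]
    have : (fun x : UnitAddTorus (Fin 2) => P ((fun v : C(UnitAddTorus (Fin 2), EuclideanSpace ℝ (Fin 2)) => (v, x)) ⁻¹' S)) =ᵐ[volume] 0 := by
      filter_upwards [hzero] with x hx
      simpa [hS_def] using hx
    rw [lintegral_congr_ae this]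
    simp
  -- hence `vol {x | v x = 0} = 0` for `P`-a.e. `v`
  have hae : ∀ᵐ v ∂P, (volume : Measure (UnitAddTorus (Fin 2))) {x | v x = 0} = 0 := by
    rw [Measure.prod_apply hSm] at hprod
    have hmeas : Measurable fun v : C(UnitAddTorus (Fin 2), EuclideanSpace ℝ (Fin 2)) => (volume : Measure (UnitAddTorus (Fin 2))) (Prod.mk v ⁻¹' S) :=
      measurable_measure_prodMk_left hSm
    have := (lintegral_eq_zero_iff hmeas).1 hprod
    filter_upwards [this] with v hv
    simpa [hS_def] using hv
  filter_upwards [hae, hdiv] with v hv hvdiv T hT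
  have hren : Torus.HasRenormalizationPropertyOn T (fun _ x => v x) := hcore (fun x => v x) v.continuous hvdiv hv T hT
  -- the autonomous continuous field is bounded on the slab `(0,T) × T²` (maximum of `‖v‖` on the compact torus)
  have hbd : Torus.IsBoundedOnSlab T (fun (_ : ℝ) (x : UnitAddTorus (Fin 2)) => v x) := by
    have hcont : Continuous (FunctionSpaces.Torus.stLift (fun (_ : ℝ) (x : UnitAddTorus (Fin 2)) => v x)) := by
      have : FunctionSpaces.Torus.stLift (fun (_ : ℝ) (x : UnitAddTorus (Fin 2)) => v x) =
          fun p : ℝ × EuclideanSpace ℝ (Fin 2) => v (FunctionSpaces.Torus.proj p.2) := by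
        funext p; rfl
      rw [this]
      exact v.continuous.comp (FunctionSpaces.Torus.continuous_proj.comp continuous_snd)
    obtain ⟨C, hC⟩ := (isCompact_univ.image v.continuous).isBounded.exists_norm_le
    refine memLp_top_of_bound hcont.aestronglyMeasurable C (Eventually.of_forall fun p => ?_)
    exact hC _ ⟨FunctionSpaces.Torus.proj p.2, mem_univ _, rfl⟩
  refine ⟨hren, Torus.not_allowsDissipationAnomalyOn_of_tendsto fun θin hθin θ hfam => ?_⟩
  exact (h31 (Fin 2) T hT (fun _ x => v x) hbd (Eventually.of_forall fun _ => hvdiv) hren θin hθin θ hfam).1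

end Literature.Analysis.FluidPDE

end
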